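import Literature.NumberTheory.Automorphic.UnitaryGroupBorelInduction
import HarnessLib

/-!
# The Heisenberg chart of the unipotent radical `N` of the Borel subgroup of the quasi-split `U(3) = U(σ, Φ₃)(R)` over a
# commutative topological ring `R` with an involution `σ` and `2 ∈ Rˣ`: `N ≃ₜ R × R⁻`, the group law and the torus
# conjugation in coordinates

Topic `NumberTheory/Automorphic`; namespace `Literature.NumberTheory.Automorphic.UnitaryGroup.HeisRing`.  KERNEL MATHEMATICS:
definitions with bodies + theorems; no named fact, no `sorry`, no instance, no notation.  This is the RING-GENERIC twin of the adelic ★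
`UnitaryGroupHeisenberg` (which is typed on `𝔸_E`, `conjAdele`, `borelAdelic`): here `R` is any commutative ring with a ring
endomorphism `σ` satisfying `σ ∘ σ = id` and `[Invertible (2 : R)]`, the group is the subtype group `↥(unitaryGroupOfForm σ J)` with
`J = Φ₃` (hypothesis `hJ : J = (StdForm.antidiagonal 3).over R`, as in ★ `UnitaryGroupBorelInduction.borelTriple`), and `N`, `T`, `B` are
★ `unipotentU ∕ torusU ∕ borelU σ J`.  Instantiated at `R = L ⊗_{L⁺} L⁺_v = ∏_{w ∣ v} L_w`, `σ = c ⊗ 1` (★ `conjLocal`) it is the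
Heisenberg group of `U(Φ₃)(L⁺_v)` [Rogawski1990 §1.10 «`N = {u(x, z) : x x̄ = z + z̄}`»]; the topology, the Haar measure and
the Borel modulus `δ_B(d(α, β, ᾱ⁻¹)) = ‖α‖²` are the sequel `UnitaryGroupHeisenbergRingHaar`.

* §1 `R⁻ = skewPart σ := {y : σ y = -y}` (an `AddSubgroup`), the chart `heisElt hσ hJ x y = u(x, y − ½ x σx) ∈ N` and its inverse
  `heisX u = u₀₁`, `heisY hσ hJ u = u₀₂ + ½ u₀₁ σ(u₀₁) ∈ R⁻` (the `(1,2)` and `(2,2)` unitarity relations `u₁₂ = −σ u₀₁`,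
  `u₀₂ + σ u₀₂ + u₀₁ σ u₀₁ = 0`).
* §2 the group law in coordinates: `x(uv) = x(u) + x(v)`, `y(uv) = y(u) + y(v) + ½ (x(v) σx(u) − x(u) σx(v))`; left translation
  is a shear `(x, y) ↦ (x(u₀) + x, y + s(u₀, x))`.
* §3 conjugation by the torus: for `t = diag(d) ∈ T`, `x(t⁻¹ u t) = d₀⁻¹ d₁ x(u)`, `y(t⁻¹ u t) = d₀⁻¹ d₂ y(u)`, and the torus
  relations `σ(d₂) d₀ = 1`, `σ(d₁) d₁ = 1`, so `d₀⁻¹ d₂ = (d₀ σ d₀)⁻¹` is `σ`-fixed.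
Cell `hodgecm-mathlib` FLOOR 0, line `Cruxes/H413/Lines/F0_P2GR91NJacquet.lean` K1, piece K1m.  HC_CM is proved only modulo the 2 remaining named
inputs (hLiu418, h413) until rung 0 closes; this file discharges nothing.

## References
* [Rogawski1990] J. Rogawski, *Automorphic Representations of Unitary Groups in Three Variables*, Ann. of Math. Stud. 123 (1990), §1.10, §2.2.
* [GetzHahn2024] J. Getz, H. Hahn, *An Introduction to Automorphic Representations*, GTM 300 (2024), §3.5 Example 3.1.
-/

set_option autoImplicit false

noncomputable section

open scoped Matrix MatrixGroups

namespace Literature.NumberTheory.Automorphic.UnitaryGroup.HeisRing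

open Literature.NumberTheory.Automorphic Literature.NumberTheory.Automorphic.UnitaryGroup

section Algebra

variable {R : Type*} [CommRing R] (σ : R →+* R) (hσ : ∀ x, σ (σ x) = x) [Invertible (2 : R)]
  {J : Matrix (Fin 3) (Fin 3) R} (hJ : J = (StdForm.antidiagonal 3).over R)

/-! ## §1 `R⁻`, the chart and its inverse -/

/-- **`R⁻ = {y ∈ R : σ y = -y}`**, the `σ`-skew elements (for `R = L ⊗ L⁺_v`: the trace-zero part `δ · (L⁺ ⊗ L⁺_v)`), an additive subgroup.
[cite: Rogawski1990, §1.10 p. 9] -/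
def skewPart : AddSubgroup R where
  carrier := {y | σ y = -y}
  zero_mem' := by simp
  add_mem' := by intro a b ha hb; simp only [Set.mem_setOf_eq] at ha hb ⊢; rw [map_add, ha, hb, neg_add]
  neg_mem' := by intro a ha; simp only [Set.mem_setOf_eq] at ha ⊢; rw [map_neg, ha]

omit [Invertible (2 : R)] in
/-- Membership in `R⁻`. [cite: Rogawski1990, §1.10 p. 9] -/
@[simp] theorem mem_skewPart_iff (y : R) : y ∈ skewPart σ ↔ σ y = -y := Iff.rfl

omit [Invertible (2 : R)] in
/-- `R⁻` is stable under multiplication by `σ`-fixed scalars. [cite: Rogawski1990, §1.10 p. 9] -/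
theorem mul_mem_skewPart {l y : R} (hl : σ l = l) (hy : y ∈ skewPart σ) : l * y ∈ skewPart σ := by
  rw [mem_skewPart_iff] at hy ⊢
  rw [map_mul, hl, hy, mul_neg]

/-- the matrix of an element of the subtype group `U(σ, J)(R)`. [folklore] -/
private abbrev mat (g : ↥(unitaryGroupOfForm σ J)) : Matrix (Fin 3) (Fin 3) R := ((g : GL (Fin 3) R) : Matrix (Fin 3) (Fin 3) R)

/-- `½ + ½ = 1`. [folklore] -/
private theorem half_add_half : (⅟(2 : R)) + ⅟(2 : R) = 1 := by
  rw [← two_mul, mul_invOf_self]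

/-- The `z`-entry `z = y − ½ x σ(x)` of the chart. [cite: Rogawski1990, §1.10 p. 9] -/
def heisZ (x y : R) : R := y - ⅟(2 : R) * (x * σ x)

include hσ in
/-- **The defining relation `z + σ(z) + x σ(x) = 0`** of `N` holds for `z = y − ½ x σ(x)`, `y ∈ R⁻`. [cite: Rogawski1990, §1.10 p. 9] -/
theorem heisZ_add_map (x : R) {y : R} (hy : y ∈ skewPart σ) (h2 : σ (⅟(2 : R)) = ⅟(2 : R)) :
    heisZ σ x y + σ (heisZ σ x y) = -(x * σ x) := by
  rw [mem_skewPart_iff] at hy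
  simp only [heisZ, map_sub, map_mul, h2, hσ, hy]
  linear_combination (-(x * σ x)) * half_add_half (R := R)

/-- `σ(½) = ½` for a ring endomorphism. [cite: Rogawski1990, §1.10 p. 9] -/
theorem map_invOf_two : σ (⅟(2 : R)) = ⅟(2 : R) := by
  have h2 : σ (2 : R) = 2 := map_ofNat σ 2
  have h : σ (⅟(2 : R)) * 2 = 1 := by
    calc σ (⅟(2 : R)) * 2 = σ (⅟(2 : R)) * σ 2 := by rw [h2]
      _ = σ (⅟(2 : R) * 2) := by rw [map_mul]
      _ = 1 := by rw [invOf_mul_self, map_one]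
  exact (invOf_eq_left_inv h).symm

/-- The matrix `u(x, z) = [[1, x, z], [0, 1, -σ(x)], [0, 0, 1]]`, `z = y − ½ x σ(x)`. [cite: Rogawski1990, §1.10 p. 9] -/
def heisMatrix (x y : R) : Matrix (Fin 3) (Fin 3) R := !![1, x, heisZ σ x y; 0, 1, -σ x; 0, 0, 1]

/-- The inverse matrix `[[1, -x, σ(z)], [0, 1, σ(x)], [0, 0, 1]]` (valid when `z + σ(z) + x σ(x) = 0`). [cite: Rogawski1990, §1.10 p. 9] -/
def heisMatrixInv (x y : R) : Matrix (Fin 3) (Fin 3) R := !![1, -x, σ (heisZ σ x y); 0, 1, σ x; 0, 0, 1]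

include hσ in
/-- `u · u⁻¹ = 1`. [cite: Rogawski1990, §1.10 p. 9] -/
theorem heisMatrix_mul_heisMatrixInv (x : R) {y : R} (hy : y ∈ skewPart σ) : heisMatrix σ x y * heisMatrixInv σ x y = 1 := by
  have hrel := heisZ_add_map σ hσ x hy (map_invOf_two σ)
  ext i j
  fin_cases i <;> fin_cases j <;> simp [heisMatrix, heisMatrixInv, Matrix.mul_apply, Fin.sum_univ_three]
  all_goals linear_combination hrel

include hσ in
/-- `u⁻¹ · u = 1`. [cite: Rogawski1990, §1.10 p. 9] -/
theorem heisMatrixInv_mul_heisMatrix (x : R) {y : R} (hy : y ∈ skewPart σ) : heisMatrixInv σ x y * heisMatrix σ x y = 1 := by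
  have hrel := heisZ_add_map σ hσ x hy (map_invOf_two σ)
  ext i j
  fin_cases i <;> fin_cases j <;> simp [heisMatrix, heisMatrixInv, Matrix.mul_apply, Fin.sum_univ_three]
  all_goals linear_combination hrel

/-- `u(x, z)` as an invertible matrix. [cite: Rogawski1990, §1.10 p. 9] -/
def heisGL (x : R) (y : skewPart σ) : GL (Fin 3) R :=
  ⟨heisMatrix σ x y, heisMatrixInv σ x y, heisMatrix_mul_heisMatrixInv σ hσ x y.2, heisMatrixInv_mul_heisMatrix σ hσ x y.2⟩

/-- The matrix of `heisGL`. [cite: Rogawski1990, §1.10 p. 9] -/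
@[simp] theorem coe_heisGL (x : R) (y : skewPart σ) : (heisGL σ hσ x y : Matrix (Fin 3) (Fin 3) R) = heisMatrix σ x y := rfl

include hσ in
/-- **`u(x, z) ∈ U(σ, Φ₃)(R)`**: the unitarity relations reduce to `σσ = id` and `z + σ(z) + x σ(x) = 0`. [cite: Rogawski1990, §1.10 p. 9] -/
theorem heisGL_mem (x : R) (y : skewPart σ) : heisGL σ hσ x y ∈ unitaryGroupOfForm σ ((StdForm.antidiagonal 3).over R) := by
  have hrel := heisZ_add_map σ hσ x y.2 (map_invOf_two σ)
  rw [mem_unitaryGroupOfForm_antidiagonal_iff_sum']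
  have r0 : (0 : Fin 3).rev = 2 := rfl; have r1 : (1 : Fin 3).rev = 1 := rfl; have r2 : (2 : Fin 3).rev = 0 := rfl
  intro a b
  fin_cases a <;> fin_cases b <;> simp [heisMatrix, Fin.sum_univ_three, r0, r1, r2, hσ, map_neg]
  all_goals linear_combination hrel

/-- **The chart**: `heisElt x y = u(x, y − ½ x σ(x)) ∈ N` (an element of ★ `unipotentU σ J`). [cite: Rogawski1990, §1.10 p. 9] -/
def heisElt (x : R) (y : skewPart σ) : ↥(unipotentU σ J) :=
  ⟨⟨heisGL σ hσ x y, hJ ▸ heisGL_mem σ hσ x y⟩, by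
      rw [mem_unipotentU_iff]
      refine ⟨?_, fun i => ?_⟩
      · intro i j hij
        change (j : Fin 3) < i at hij
        change heisMatrix σ x y i j = 0
        fin_cases i <;> fin_cases j <;> simp [heisMatrix] at hij ⊢
      · change heisMatrix σ x y i i = 1
        fin_cases i <;> simp [heisMatrix]⟩

/-- Entries of the chart: the matrix of `heisElt x y` is `heisMatrix x y`. [cite: Rogawski1990, §1.10 p. 9] -/
theorem mat_heisElt (x : R) (y : skewPart σ) :
    (((heisElt σ hσ hJ x y : ↥(unipotentU σ J)) : ↥(unitaryGroupOfForm σ J)) : GL (Fin 3) R) = heisGL σ hσ x y := rfl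

/-- the matrix of `u ∈ N`. [folklore] -/
private abbrev umat (u : ↥(unipotentU σ J)) : Matrix (Fin 3) (Fin 3) R := (((u : ↥(unitaryGroupOfForm σ J)) : GL (Fin 3) R) : Matrix (Fin 3) (Fin 3) R)

omit [Invertible (2 : R)] in
/-- `umat (u v) = umat u * umat v`. [folklore] -/
private theorem umat_mul (u v : ↥(unipotentU σ J)) : umat σ (u * v) = umat σ u * umat σ v := by
  simp only [umat, Subgroup.coe_mul, Units.val_mul]

omit [Invertible (2 : R)] in
/-- Shape of `u ∈ N`: unitriangular. [folklore] -/
private theorem umat_shape (u : ↥(unipotentU σ J)) :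
    umat σ u 1 0 = 0 ∧ umat σ u 2 0 = 0 ∧ umat σ u 2 1 = 0 ∧ umat σ u 0 0 = 1 ∧ umat σ u 1 1 = 1 ∧ umat σ u 2 2 = 1 := by
  obtain ⟨htri, hdiag⟩ := (mem_unipotentU_iff (u : ↥(unitaryGroupOfForm σ J))).1 u.2
  exact ⟨htri (by decide), htri (by decide), htri (by decide), hdiag 0, hdiag 1, hdiag 2⟩

omit [Invertible (2 : R)] in
include hJ in
/-- the unitarity sums of `u ∈ N ≤ U(σ, Φ₃)`. [folklore] -/
private theorem umat_sum (u : ↥(unipotentU σ J)) (a b : Fin 3) :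
    ∑ i, σ (umat σ u i a) * umat σ u (Fin.rev i) b = if b = Fin.rev a then 1 else 0 := by
  have hu : ((u : ↥(unitaryGroupOfForm σ J)) : GL (Fin 3) R) ∈ unitaryGroupOfForm σ ((StdForm.antidiagonal 3).over R) := by
    rw [← hJ]; exact (u : ↥(unitaryGroupOfForm σ J)).2
  exact (mem_unitaryGroupOfForm_antidiagonal_iff_sum' σ 3 _).1 hu a b

omit [Invertible (2 : R)] in
include hJ in
/-- **`u₁₂ = -σ(u₀₁)`** on `N` (the `(1, 2)` unitarity relation). [cite: Rogawski1990, §1.10 p. 9] -/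
theorem umat_one_two (u : ↥(unipotentU σ J)) :
    (((u : ↥(unitaryGroupOfForm σ J)) : GL (Fin 3) R) : Matrix (Fin 3) (Fin 3) R) 1 2 =
      -σ ((((u : ↥(unitaryGroupOfForm σ J)) : GL (Fin 3) R) : Matrix (Fin 3) (Fin 3) R) 0 1) := by
  have key := umat_sum σ hJ u 1 2
  obtain ⟨-, -, h21, -, h11, h22⟩ := umat_shape σ u
  have r0 : (0 : Fin 3).rev = 2 := rfl; have r1 : (1 : Fin 3).rev = 1 := rfl; have r2 : (2 : Fin 3).rev = 0 := rfl
  simp only [Fin.sum_univ_three, r0, r1, r2, show ((2 : Fin 3) = 1) = False by decide, if_false] at key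
  change σ (umat σ u 0 1) * umat σ u 2 2 + σ (umat σ u 1 1) * umat σ u 1 2 + σ (umat σ u 2 1) * umat σ u 0 2 = 0 at key
  rw [h22, h11, h21, map_one, map_zero, mul_one, one_mul, zero_mul, add_zero] at key
  change umat σ u 1 2 = -σ (umat σ u 0 1)
  linear_combination key

omit [Invertible (2 : R)] in
include hσ hJ in
/-- **`u₀₂ + σ(u₀₂) + u₀₁ σ(u₀₁) = 0`** on `N` (the `(2, 2)` unitarity relation; Rogawski's `x x̄ + z + z̄ = 0`). [cite: Rogawski1990, §1.10 p. 9] -/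
theorem umat_zero_two_add_map (u : ↥(unipotentU σ J)) :
    (((u : ↥(unitaryGroupOfForm σ J)) : GL (Fin 3) R) : Matrix (Fin 3) (Fin 3) R) 0 2 +
        σ ((((u : ↥(unitaryGroupOfForm σ J)) : GL (Fin 3) R) : Matrix (Fin 3) (Fin 3) R) 0 2) =
      -((((u : ↥(unitaryGroupOfForm σ J)) : GL (Fin 3) R) : Matrix (Fin 3) (Fin 3) R) 0 1 *
        σ ((((u : ↥(unitaryGroupOfForm σ J)) : GL (Fin 3) R) : Matrix (Fin 3) (Fin 3) R) 0 1)) := by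
  have key := umat_sum σ hJ u 2 2
  obtain ⟨-, -, -, -, -, h22⟩ := umat_shape σ u
  have h12 := umat_one_two σ hJ u
  have r0 : (0 : Fin 3).rev = 2 := rfl; have r1 : (1 : Fin 3).rev = 1 := rfl; have r2 : (2 : Fin 3).rev = 0 := rfl
  simp only [Fin.sum_univ_three, r0, r1, r2, show ((2 : Fin 3) = 0) = False by decide, if_false] at key
  change σ (umat σ u 0 2) * umat σ u 2 2 + σ (umat σ u 1 2) * umat σ u 1 2 + σ (umat σ u 2 2) * umat σ u 0 2 = 0 at key
  change umat σ u 1 2 = -σ (umat σ u 0 1) at h12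
  rw [h22, h12, map_one, map_neg, hσ] at key
  change umat σ u 0 2 + σ (umat σ u 0 2) = -(umat σ u 0 1 * σ (umat σ u 0 1))
  linear_combination key

/-- **The first coordinate `x = u₀₁`.** [cite: Rogawski1990, §1.10 p. 9] -/
def heisX (u : ↥(unipotentU σ J)) : R := (((u : ↥(unitaryGroupOfForm σ J)) : GL (Fin 3) R) : Matrix (Fin 3) (Fin 3) R) 0 1

/-- **The second coordinate `y = u₀₂ + ½ u₀₁ σ(u₀₁) ∈ R⁻`.** [cite: Rogawski1990, §1.10 p. 9] -/
def heisY (u : ↥(unipotentU σ J)) : skewPart σ :=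
  ⟨(((u : ↥(unitaryGroupOfForm σ J)) : GL (Fin 3) R) : Matrix (Fin 3) (Fin 3) R) 0 2 + ⅟(2 : R) * (heisX σ u * σ (heisX σ u)), by
    rw [mem_skewPart_iff, map_add, map_mul, map_invOf_two, map_mul, hσ]
    have h := umat_zero_two_add_map σ hσ hJ u; have h2 := half_add_half (R := R)
    change _ + ⅟(2 : R) * (σ (umat σ u 0 1) * umat σ u 0 1) = -(umat σ u 0 2 + ⅟(2 : R) * (umat σ u 0 1 * σ (umat σ u 0 1)))
    linear_combination h + (umat σ u 0 1 * σ (umat σ u 0 1)) * h2⟩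

omit [Invertible (2 : R)] in
/-- `heisX` unfolded. [cite: Rogawski1990, §1.10 p. 9] -/
theorem heisX_def (u : ↥(unipotentU σ J)) : heisX σ u = (((u : ↥(unitaryGroupOfForm σ J)) : GL (Fin 3) R) : Matrix (Fin 3) (Fin 3) R) 0 1 := rfl

/-- `heisY` unfolded. [cite: Rogawski1990, §1.10 p. 9] -/
theorem coe_heisY (u : ↥(unipotentU σ J)) :
    (heisY σ hσ hJ u : R) = (((u : ↥(unitaryGroupOfForm σ J)) : GL (Fin 3) R) : Matrix (Fin 3) (Fin 3) R) 0 2 +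
      ⅟(2 : R) * (heisX σ u * σ (heisX σ u)) := rfl

/-- Round trip: `heisX (u(x, y)) = x`. [cite: Rogawski1990, §1.10 p. 9] -/
@[simp] theorem heisX_heisElt (x : R) (y : skewPart σ) : heisX σ (heisElt σ hσ hJ x y) = x := by
  simp [heisX, mat_heisElt, heisMatrix]

/-- Round trip: `heisY (u(x, y)) = y`. [cite: Rogawski1990, §1.10 p. 9] -/
@[simp] theorem heisY_heisElt (x : R) (y : skewPart σ) : heisY σ hσ hJ (heisElt σ hσ hJ x y) = y := by
  refine Subtype.ext ?_
  simp only [coe_heisY, heisX, mat_heisElt, coe_heisGL, heisMatrix, heisZ, Matrix.of_apply, Matrix.cons_val', Matrix.cons_val_zero,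
    Matrix.cons_val_one, Matrix.cons_val_two, Matrix.empty_val', Matrix.cons_val_fin_one, Matrix.head_cons, Matrix.tail_cons]
  ring

/-- Round trip: `u(heisX u, heisY u) = u`. [cite: Rogawski1990, §1.10 p. 9] -/
@[simp] theorem heisElt_heisX_heisY (u : ↥(unipotentU σ J)) : heisElt σ hσ hJ (heisX σ u) (heisY σ hσ hJ u) = u := by
  obtain ⟨h10, h20, h21, h00, h11, h22⟩ := umat_shape σ u
  have h12 := umat_one_two σ hJ u
  change umat σ u 1 2 = -σ (umat σ u 0 1) at h12
  refine Subtype.ext (Subtype.ext (Matrix.GeneralLinearGroup.ext fun i j => ?_))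
  change heisMatrix σ (heisX σ u) (heisY σ hσ hJ u) i j = umat σ u i j
  fin_cases i <;> fin_cases j <;> simp [heisMatrix, heisX, heisY, heisZ, h10, h20, h21, h00, h11, h22, h12]

/-! ## §2 The group law in coordinates -/

omit [Invertible (2 : R)] in
/-- **`x(u v) = x(u) + x(v)`.** [cite: Rogawski1990, §1.10 p. 9] -/
theorem heisX_mul (u v : ↥(unipotentU σ J)) : heisX σ (u * v) = heisX σ u + heisX σ v := by
  obtain ⟨-, -, hv21, -, hv11, -⟩ := umat_shape σ v; obtain ⟨-, -, -, hu00, -, -⟩ := umat_shape σ u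
  change umat σ (u * v) 0 1 = umat σ u 0 1 + umat σ v 0 1
  rw [umat_mul, Matrix.mul_apply, Fin.sum_univ_three, hu00, hv11, hv21]
  ring

/-- **`y(u v) = y(u) + y(v) + ½ (x(v) σx(u) − x(u) σx(v))`** (the commutator cocycle). [cite: Rogawski1990, §1.10 p. 9] -/
theorem coe_heisY_mul (u v : ↥(unipotentU σ J)) :
    (heisY σ hσ hJ (u * v) : R) = (heisY σ hσ hJ u : R) + (heisY σ hσ hJ v : R) +
      ⅟(2 : R) * (heisX σ v * σ (heisX σ u) - heisX σ u * σ (heisX σ v)) := by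
  obtain ⟨-, -, -, hu00, -, -⟩ := umat_shape σ u; obtain ⟨-, -, -, -, -, hv22⟩ := umat_shape σ v
  have hv12 : umat σ v 1 2 = -σ (umat σ v 0 1) := umat_one_two σ hJ v
  have e1 : (heisY σ hσ hJ (u * v) : R) = umat σ (u * v) 0 2 + ⅟(2 : R) * (umat σ (u * v) 0 1 * σ (umat σ (u * v) 0 1)) := rfl; have e2 : (heisY σ hσ hJ u : R) = umat σ u 0 2 + ⅟(2 : R) * (umat σ u 0 1 * σ (umat σ u 0 1)) := rfl; have e3 :
    (heisY σ hσ hJ v : R) = umat σ v 0 2 + ⅟(2 : R) * (umat σ v 0 1 * σ (umat σ v 0 1)) := rfl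
  have ex : heisX σ u = umat σ u 0 1 := rfl; have ey : heisX σ v = umat σ v 0 1 := rfl
  have h01 : umat σ (u * v) 0 1 = umat σ u 0 1 + umat σ v 0 1 := heisX_mul σ u v
  have h02 : umat σ (u * v) 0 2 = umat σ v 0 2 + umat σ u 0 1 * umat σ v 1 2 + umat σ u 0 2 := by
    rw [umat_mul, Matrix.mul_apply, Fin.sum_univ_three, hu00, hv22]; ring
  rw [e1, e2, e3, ex, ey, h01, h02, hv12, map_add]
  linear_combination (umat σ u 0 1 * σ (umat σ v 0 1)) * half_add_half (R := R)

/-- **Left translation, first coordinate**: `x(u₀ · u(x, y)) = x(u₀) + x`. [cite: Rogawski1990, §1.10 p. 9] -/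
theorem heisX_mul_heisElt (u₀ : ↥(unipotentU σ J)) (x : R) (y : skewPart σ) :
    heisX σ (u₀ * heisElt σ hσ hJ x y) = heisX σ u₀ + x := by
  rw [heisX_mul, heisX_heisElt]

/-- **Left translation, second coordinate**: `y(u₀ · u(x, y)) = y + (y(u₀) + ½ (x σx(u₀) − x(u₀) σ x))`. [cite: Rogawski1990, §1.10 p. 9] -/
theorem coe_heisY_mul_heisElt (u₀ : ↥(unipotentU σ J)) (x : R) (y : skewPart σ) :
    (heisY σ hσ hJ (u₀ * heisElt σ hσ hJ x y) : R) = (y : R) + ((heisY σ hσ hJ u₀ : R) + ⅟(2 : R) * (x * σ (heisX σ u₀) - heisX σ u₀ * σ x)) := by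
  rw [coe_heisY_mul, heisX_heisElt, heisY_heisElt]
  ring

include hσ in
/-- The shear `y(u₀) + ½ (x σx(u₀) − x(u₀) σx)` lies in `R⁻`. [cite: Rogawski1990, §1.10 p. 9] -/
theorem heisShift_mem (u₀ : ↥(unipotentU σ J)) (x : R) :
    (heisY σ hσ hJ u₀ : R) + ⅟(2 : R) * (x * σ (heisX σ u₀) - heisX σ u₀ * σ x) ∈ skewPart σ := by
  refine (skewPart σ).add_mem (heisY σ hσ hJ u₀).2 ?_
  rw [mem_skewPart_iff, map_mul, map_invOf_two, map_sub, map_mul, map_mul, hσ, hσ]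
  ring

/-- The shear element of `R⁻`. [cite: Rogawski1990, §1.10 p. 9] -/
def heisShift (u₀ : ↥(unipotentU σ J)) (x : R) : skewPart σ :=
  ⟨(heisY σ hσ hJ u₀ : R) + ⅟(2 : R) * (x * σ (heisX σ u₀) - heisX σ u₀ * σ x), heisShift_mem σ hσ hJ u₀ x⟩

/-- **Left translation in the chart is a shear**: `u₀ · u(x, y) = u(x(u₀) + x, y + s(u₀, x))`. [cite: Rogawski1990, §1.10 p. 9] -/
theorem mul_heisElt (u₀ : ↥(unipotentU σ J)) (x : R) (y : skewPart σ) :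
    u₀ * heisElt σ hσ hJ x y = heisElt σ hσ hJ (heisX σ u₀ + x) (y + heisShift σ hσ hJ u₀ x) := by
  rw [← heisElt_heisX_heisY σ hσ hJ (u₀ * heisElt σ hσ hJ x y), heisX_mul_heisElt]
  congr 1
  exact Subtype.ext (coe_heisY_mul_heisElt σ hσ hJ u₀ x y)

/-! ## §3 Conjugation by the torus -/

omit [Invertible (2 : R)] in
include hJ in
/-- **The torus relations**: for `t = diag(d) ∈ T ≤ U(σ, Φ₃)`, `σ(d (rev i)) · d i = 1`; in particular `σ(d₂) d₀ = 1`, `σ(d₁) d₁ = 1`,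
`σ(d₀) d₂ = 1` (`d = (α, β, σ(α)⁻¹)`). [cite: Rogawski1990, §1.10 p. 9] -/
theorem torus_relations (t : ↥(torusU σ J)) {d : Fin 3 → Rˣ} (hd : glDiagonal 3 R d = ((t : ↥(unitaryGroupOfForm σ J)) : GL (Fin 3) R)) :
    σ (d 2 : R) * d 0 = 1 ∧ σ (d 1 : R) * d 1 = 1 ∧ σ (d 0 : R) * d 2 = 1 := by
  have hU : glDiagonal 3 R d ∈ unitaryGroupOfForm σ ((StdForm.antidiagonal 3).over R) := by
    rw [hd, ← hJ]; exact (t : ↥(unitaryGroupOfForm σ J)).2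
  have h := (glDiagonal_mem_unitaryGroupOfForm_antidiagonal_iff σ 3 d).1 hU
  exact ⟨h 0, h 1, h 2⟩

omit [Invertible (2 : R)] in
include hJ in
/-- On the torus, `σ(d₀⁻¹) = d₂` (from `σ(d₀) d₂ = 1`). [cite: Rogawski1990, §1.10 p. 9] -/
theorem map_inv_d0 (t : ↥(torusU σ J)) {d : Fin 3 → Rˣ} (hd : glDiagonal 3 R d = ((t : ↥(unitaryGroupOfForm σ J)) : GL (Fin 3) R)) :
    σ (((d 0)⁻¹ : Rˣ) : R) = (d 2 : R) := by
  obtain ⟨-, -, h02⟩ := torus_relations σ hJ t hd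
  calc σ (((d 0)⁻¹ : Rˣ) : R) = σ (((d 0)⁻¹ : Rˣ) : R) * (σ (d 0 : R) * (d 2 : R)) := by rw [h02, mul_one]
    _ = σ ((((d 0)⁻¹ : Rˣ) : R) * (d 0 : R)) * (d 2 : R) := by rw [map_mul, mul_assoc]
    _ = (d 2 : R) := by rw [Units.inv_mul, map_one, one_mul]

omit [Invertible (2 : R)] in
include hJ in
/-- On the torus, `σ(d₂) = d₀⁻¹` (from `σ(d₂) d₀ = 1`). [cite: Rogawski1990, §1.10 p. 9] -/
theorem map_d2 (t : ↥(torusU σ J)) {d : Fin 3 → Rˣ} (hd : glDiagonal 3 R d = ((t : ↥(unitaryGroupOfForm σ J)) : GL (Fin 3) R)) :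
    σ (d 2 : R) = (((d 0)⁻¹ : Rˣ) : R) := by
  obtain ⟨h20, -, -⟩ := torus_relations σ hJ t hd
  rw [← mul_one (σ (d 2 : R)), ← Units.mul_inv (d 0), ← mul_assoc, h20, one_mul]

omit [Invertible (2 : R)] in
include hJ in
/-- The scalar `d₀⁻¹ d₂ = (d₀ σ(d₀))⁻¹` of the torus is `σ`-fixed. [cite: Rogawski1990, §1.10 p. 9] -/
theorem map_torusCentralScalar (t : ↥(torusU σ J)) {d : Fin 3 → Rˣ}
    (hd : glDiagonal 3 R d = ((t : ↥(unitaryGroupOfForm σ J)) : GL (Fin 3) R)) :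
    σ (((d 0)⁻¹ * d 2 : Rˣ) : R) = ((d 0)⁻¹ * d 2 : Rˣ) := by
  rw [Units.val_mul, map_mul, map_inv_d0 σ hJ t hd, map_d2 σ hJ t hd, mul_comm]

omit [Invertible (2 : R)] in
/-- matrix of the conjugate `t⁻¹ u t` entrywise. [folklore] -/
private theorem umat_conj (t : ↥(torusU σ J)) {d : Fin 3 → Rˣ} (hd : glDiagonal 3 R d = ((t : ↥(unitaryGroupOfForm σ J)) : GL (Fin 3) R))
    (u : ↥(unitaryGroupOfForm σ J)) (i j : Fin 3) :
    ((((t : ↥(unitaryGroupOfForm σ J))⁻¹ * u * (t : ↥(unitaryGroupOfForm σ J)) : ↥(unitaryGroupOfForm σ J)) : GL (Fin 3) R) :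
        Matrix (Fin 3) (Fin 3) R) i j = ((d i)⁻¹ : Rˣ) * mat σ u i j * d j := by
  have ht : (((t : ↥(unitaryGroupOfForm σ J)) : GL (Fin 3) R) : Matrix (Fin 3) (Fin 3) R) = Matrix.diagonal fun k => (d k : R) := by
    rw [← hd, coe_glDiagonal]
  have hti : ((((t : ↥(unitaryGroupOfForm σ J))⁻¹ : ↥(unitaryGroupOfForm σ J)) : GL (Fin 3) R) : Matrix (Fin 3) (Fin 3) R) =
      Matrix.diagonal fun k => (((d k)⁻¹ : Rˣ) : R) := by rw [Subgroup.coe_inv, ← hd, ← map_inv, coe_glDiagonal]; rfl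
  rw [Subgroup.coe_mul, Subgroup.coe_mul, Units.val_mul, Units.val_mul, hti, ht, Matrix.mul_apply, Fintype.sum_eq_single j, Matrix.mul_apply,
    Fintype.sum_eq_single i, Matrix.diagonal_apply_eq, Matrix.diagonal_apply_eq]
  · intro k hk; rw [Matrix.diagonal_apply_ne _ (Ne.symm hk), zero_mul]
  · intro k hk; rw [Matrix.diagonal_apply_ne _ hk, mul_zero]

/-- `t⁻¹ u t ∈ N` for `u ∈ N`, `t ∈ T` (as an element of `N`). [cite: Rogawski1990, §1.10 p. 9] -/
def torusConj (t : ↥(torusU σ J)) (u : ↥(unipotentU σ J)) : ↥(unipotentU σ J) :=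
  ⟨(t : ↥(unitaryGroupOfForm σ J))⁻¹ * u * (t : ↥(unitaryGroupOfForm σ J)), by
    have h := (borelU_le_normalizer σ J) (torusU_le_borelU σ J t.2)
    rw [Subgroup.mem_normalizer_iff] at h
    have h' := (h ((t : ↥(unitaryGroupOfForm σ J))⁻¹ * u * (t : ↥(unitaryGroupOfForm σ J)))).2
    have : (t : ↥(unitaryGroupOfForm σ J)) * ((t : ↥(unitaryGroupOfForm σ J))⁻¹ * u * (t : ↥(unitaryGroupOfForm σ J))) *
        (t : ↥(unitaryGroupOfForm σ J))⁻¹ = u := by group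
    exact (this ▸ h') u.2⟩

omit [Invertible (2 : R)] in
/-- `torusConj t u = t⁻¹ u t` in `U(σ, J)`. [cite: Rogawski1990, §1.10 p. 9] -/
@[simp] theorem coe_torusConj (t : ↥(torusU σ J)) (u : ↥(unipotentU σ J)) :
    ((torusConj σ t u : ↥(unipotentU σ J)) : ↥(unitaryGroupOfForm σ J)) =
      (t : ↥(unitaryGroupOfForm σ J))⁻¹ * u * (t : ↥(unitaryGroupOfForm σ J)) := rfl

omit [Invertible (2 : R)] in
/-- **Torus conjugation, first coordinate**: `x(t⁻¹ u t) = d₀⁻¹ d₁ x(u)`. [cite: Rogawski1990, §1.10 p. 9] -/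
theorem heisX_torusConj (t : ↥(torusU σ J)) {d : Fin 3 → Rˣ} (hd : glDiagonal 3 R d = ((t : ↥(unitaryGroupOfForm σ J)) : GL (Fin 3) R))
    (u : ↥(unipotentU σ J)) : heisX σ (torusConj σ t u) = (((d 0)⁻¹ * d 1 : Rˣ) : R) * heisX σ u := by
  rw [heisX_def, coe_torusConj, umat_conj σ t hd, heisX_def, Units.val_mul]
  ring

/-- **Torus conjugation, second coordinate**: `y(t⁻¹ u t) = d₀⁻¹ d₂ y(u)` (`σ(d₁) d₁ = 1`). [cite: Rogawski1990, §1.10 p. 9] -/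
theorem coe_heisY_torusConj (t : ↥(torusU σ J)) {d : Fin 3 → Rˣ} (hd : glDiagonal 3 R d = ((t : ↥(unitaryGroupOfForm σ J)) : GL (Fin 3) R))
    (u : ↥(unipotentU σ J)) : (heisY σ hσ hJ (torusConj σ t u) : R) = (((d 0)⁻¹ * d 2 : Rˣ) : R) * (heisY σ hσ hJ u : R) := by
  obtain ⟨-, h11, -⟩ := torus_relations σ hJ t hd
  have e1 : σ (((d 0)⁻¹ : Rˣ) : R) * σ (d 1 : R) * ((((d 0)⁻¹ : Rˣ) : R) * (d 1 : R)) = (((d 0)⁻¹ : Rˣ) : R) * (d 2 : R) := by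
    rw [map_inv_d0 σ hJ t hd]
    linear_combination ((d 2 : R) * (((d 0)⁻¹ : Rˣ) : R)) * h11
  rw [coe_heisY, coe_heisY, heisX_torusConj σ t hd, coe_torusConj, umat_conj σ t hd, Units.val_mul, Units.val_mul, map_mul, map_mul]
  change (((d 0)⁻¹ : Rˣ) : R) * (((u : ↥(unitaryGroupOfForm σ J)) : GL (Fin 3) R) : Matrix (Fin 3) (Fin 3) R) 0 2 * (d 2 : R) + _ = _
  linear_combination (⅟(2 : R) * heisX σ u * σ (heisX σ u)) * e1

end Algebra

end Literature.NumberTheory.Automorphic.UnitaryGroup.HeisRing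

end
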